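import Summits.BirchSwinnertonDyer.BirchSwinnertonDyer.Theorems.SmallImageMuTransferMuTransferX9LocalQTermFamily
import HarnessLib

/-!
# K6 crux `MuTransferX9` (stmt-BirchSwinnertonDyer-19276), CORE-PLAN S4.3 ASSERTED (file 5/5):
# MU-TRANSFER-PROOF Lemma 1 (iii) on the genuine local objects — at an `E`-split prime the `tr × ur`
# local cup product in value coordinates IS the Gorenstein pairing `⟨x(t₀), y(Fr)⟩_(A_J)` up to a UNIT `u_q(T)`

Cell `bsd-smallim`, seat `bsd-smallim-koly` gen 8 (route `SmallImageMuTransfer`, rung K6, leaf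
`Rank1Residual.BSDpOnClassX9`). HONEST FRAMING: TOOL theorems; no definition, no named fact, no `sorry`;
nothing is asserted about any curve and nothing is booked. Serves the registered stub `stub_stepsTwoFourX9`
of crux 19276 (skeleton v5 bbfcbeb8eb041500; the q-TERM of MU-TRANSFER-PROOF §5 STEP 4 = Lemma 1 (iii))
and credits nothing toward its closure (`--supports … --as helper`). PARTITION (D-0054): X9 (A4) ×
p ∈ {5, 7} · X10b∧¬Surj (A5) × p = 3 (everything is stated for an odd prime / any number field) — helper;
closes NONE.

## Content
* **`exists_unit_inv_cupProduct_eq_sum_convCoeff`** — file 4's identity with **`u_0 ≠ 0`**: if `u_0 = 0`,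
  the transverse class `T^(J−1−s)[φ]` with `φ(t₀) = T^s δ_0 v₀` is non-zero (value `δ_(J−1) v₀`, `ι e(v₀,w₀)
  = 1`) but pairs to zero with every unramified class (the identity at `k = s`), contradicting file 3's
  perfectness `exists_unramified_cupProduct_ne_zero_of_transverse`.
USE (for the assembler of `stub_stepsTwoFourX9` / the STEP-4 hand): with x10's vanishing
`inv_q(T_q^k (loc_q κ_q) ∪ loc_q(T^ε Ψ)) = 0 ∀ k` (p447084…p450663; `P` := the restricted
`twistContPairing`, `S` := `(twistModPShift).restrictField K_q`, `hP`/`hS` by `rfl`) this theorem gives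
`Σ_(j≤k) u_j ι C_(k−j)(κ_q(t₀), T^ε Ψc(Fr)) = 0 ∀ k < J` with `u_0 ≠ 0`, hence (x10's
`eq_zero_of_forall_sum_range_mul_eq_zero`) `C_i(κ_q(t₀), Ψc(Fr)) = 0 ∀ i + ε < J`: the stub's conclusion
once G3 supplies `κ_q(t₀) = U(S)·T^(e+a) k₁`.

References: B. Mazur, K. Rubin, Mem. AMS 799 (2004) Prop. 1.3.2 [MazurRubin2004]; K. Rubin, PCMI 18
(2011) Prop. 1.9.5 [Rubin2011]; B. Howard, Compositio 140 (2004) Prop. 3.2.4 [Howard2004HeegnerKolyvagin];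
HOME/koly/MU-TRANSFER-PROOF.md §2 Lemma 1 (iii), §5 STEP 4; HOME/koly/KOLY-MEMO.md §5.11.B.
-/

set_option linter.dupNamespace false
set_option autoImplicit false

noncomputable section

open scoped Classical ContRepresentation

universe u

namespace Summit.BirchSwinnertonDyer.BirchSwinnertonDyer.Rank1Residual.LocalSplitPrime

open CategoryTheory ContinuousCohomology Function Field ValuativeRel NumberField IsDedekindDomain Finset
open Literature.NumberTheory.GaloisRepresentations
open Literature.NumberTheory.GaloisRepresentations.IsNonarchimedeanLocalField
open _root_.TopRep
open Literature.NumberTheory.GaloisCohomology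
open Literature.NumberTheory.EllipticCurves
open Summit.BirchSwinnertonDyer.Rank1Residual.GaloisImage
open Summit.BirchSwinnertonDyer.Rank1Residual (X11b.LocBridge.mem_unramifiedSubgroup_one_iff_forall_eq_zero)

section QTerm

variable {K : Type u} [Field K] [NumberField K] {p : ℕ} [Fact p.Prime]
  {M M' : Type u} [AddCommGroup M] [TopologicalSpace M] [DiscreteTopology M] [Finite M]
  [AddCommGroup M'] [TopologicalSpace M'] [DiscreteTopology M'] [Finite M']
  (ρ : DiscreteGaloisModule K M) (ρ' : DiscreteGaloisModule K M')
  (hM : ∀ x : M, p • x = 0) (hM' : ∀ x : M', p • x = 0) (κ : ZpExtension K p) (J : ℕ)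
  (q : HeightOneSpectrum (𝓞 K)) [Fact (Ideal.absNorm q.asIdeal).Prime]
  [NeZero ((Ideal.absNorm q.asIdeal : ℕ) : q.adicCompletion K)]
  -- cup products on `Γ_{K_q}` need `LocallyCompactSpace` (a `Prop`; the tree's theorem
  -- `absoluteGaloisGroup_compactSpace` provides it — taken as an instance binder, as in x10's StepFour files)
  [LocallyCompactSpace (absoluteGaloisGroup (q.adicCompletion K))]

/-- **MU-TRANSFER-PROOF Lemma 1 (iii) on the genuine local objects, up to a unit (KOLY-MEMO §5.11.B).**
Setting: a number field `K`, an odd prime `p`, finite discrete `Γ_K`-modules `M`, `M′` killed by `p`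
with a `Γ_K`-equivariant PERFECT pairing `e : M × M′ → μ_p` (`hnd`, `hsurj`), a `ℤ_p`-extension `κ`, a
level `J`, and a finite place `q ∤ p` of `K` with `N(q) = ℓ`, `p ∣ ℓ − 1`, `M`, `M′` unramified at `q`,
`χ̄_ℓ` onto on inertia (`hχI`), an arithmetic Frobenius `Fr` of `K_q` which is `E`-SPLIT for both
modules (`ρ(res Fr) = 1 = ρ′(res Fr)`) of depth `m` (`res Fr ∈ Γ_m ∖ Γ_{m+1}`, `m + 1 ≤ J`), a tame
generator `t₀ ∈ I_{K_q}`, a family of local invariant maps `inv` satisfying local Tate duality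
(`inv.IsPerfect`), a trivialisation `ι : μ_p ↪ ℤ/p` with `ι(e(v₀,w₀)) = 1`, ANY local continuous pairing
`P` of `𝒯_J|_q × 𝒯′_J|_q → μ_p|_q` whose bilinear map is k6-ty's Gorenstein pairing `B = C_{J−1}` of `e`
(e.g. the restriction of `κ.twistContPairing ρ ρ′ μ_p`), and ANY equivariant `S` on `𝒯_J|_q` acting as
the shift `T` (e.g. `(κ.twistModPShift ρ hM J).restrictField K_q`); here `𝒯_J = κ.twistModP ρ J`,
`𝒯′_J = κ⁻¹.twistModP ρ′ J` (THE DUAL DEFORMATION CARRIES `χ⁻¹`).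
CONCLUSION: there is `u : ℕ → ℤ/p` with **`u 0 ≠ 0`** (a UNIT `u(T) = Σ u_j T^j ∈ A_J^×`) such that for
every `k < J`, every cocycle `φ` of `𝒯_J|_q` with TRANSVERSE class and every cocycle `ψ` of `𝒯′_J|_q`
vanishing on inertia (UNRAMIFIED),
  `inv_q( T^{J−1−k}[φ] ∪_P [ψ] ) = Σ_{j ≤ k} u_j · ι( C_{k−j}(φ(t₀), ψ(Fr)) )`,
i.e. `Σ_{k<J} inv_q(T^{J−1−k}x ∪ y)·T^k = u(T)·⟨x(t₀), y(Fr)⟩_{A_J}` in `A_J = (ℤ/p)[T]/T^J`: the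
coefficient family of the local cup product at an `E`-split prime IS the Gorenstein pairing of the
VALUES (transverse value at `t₀`, unramified value at `Fr`), up to the unit `u_q(T)` — the memo's
`inv_q(x ∪ y) = ±⟨x(σ̄), y(Fr)⟩_{A_J}` with `±` weakened to `u_q(T) ∈ A_J^×` (which STEP 4 of Theorem A
absorbs, schema hypothesis `hq`'s `U`).  Proof = KOLY-MEMO §5.11.B (N1)–(N5): the family in value
coordinates is shift-compatible (`cupProduct_adjoint` for `S`, `gorensteinPairing_shiftEnd_comm`) and
natural for the rank-one endomorphisms of `M` (every endomorphism of `M` is `Γ_{K_q}`-equivariant at an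
`E`-split prime, `toLocal_twistModP_comp_endo_of_split`), hence `u(T)·Gorenstein` by
`family_eq_weightedConv`; `u_0 ≠ 0` from `tr × ur` perfectness (`…X9LocalTransversePerfect`).
[cite: MazurRubin2004, Prop. 1.3.2 (p. 12)] [cite: Rubin2011, Prop. 1.9.5 (p. 16)]
[cite: Howard2004HeegnerKolyvagin, Prop. 3.2.4] -/
theorem exists_unit_inv_cupProduct_eq_sum_convCoeff (hp : p ≠ 2)
    {e : M →+ M' →+ DiscreteGaloisModule.MuCarrier K p}
    (he : ∀ (g : absoluteGaloisGroup K) (a : M) (b : M'),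
      e (ρ g a) (ρ' g b) = DiscreteGaloisModule.mu K p g (e a b))
    (hnd : ∀ b : M', (∀ a : M, e a b = 0) → b = 0)
    (hsurj : ∀ χ : M →+ DiscreteGaloisModule.MuCarrier K p, ∃ b : M', ∀ a, e a b = χ a)
    (ι : DiscreteGaloisModule.MuCarrier K p →+ ZMod p) (hι : Function.Injective ι)
    {v₀ : M} {w₀ : M'} (h1 : ι (e v₀ w₀) = 1)
    (hunr : GaloisRep.IsUnramifiedAt q ρ) (hunr' : GaloisRep.IsUnramifiedAt q ρ')
    (hqp : (p : 𝓞 K) ∉ q.asIdeal) (hpl : p ∣ Ideal.absNorm q.asIdeal - 1)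
    (hχI : ∀ u : (ZMod (Ideal.absNorm q.asIdeal))ˣ, ∃ t ∈ absInertia (q.adicCompletion K),
      modPCyclotomicCharacterZMod (q.adicCompletion K) (Ideal.absNorm q.asIdeal) t = u)
    {Fr : absoluteGaloisGroup (q.adicCompletion K)} (hFr : IsAbsArithFrob Fr)
    (hsplit : ρ (absGaloisRestrict K (q.adicCompletion K) Fr) = 1)
    (hsplit' : ρ' (absGaloisRestrict K (q.adicCompletion K) Fr) = 1) {m : ℕ} (hm : m + 1 ≤ J)
    (hFrm : absGaloisRestrict K (q.adicCompletion K) Fr ∈ κ.layerSubgroup m)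
    (hFrm' : absGaloisRestrict K (q.adicCompletion K) Fr ∉ κ.layerSubgroup (m + 1))
    {t₀ : absoluteGaloisGroup (q.adicCompletion K)} (ht₀ : t₀ ∈ absInertia (q.adicCompletion K))
    (hgen : ∀ u : (ZMod (Ideal.absNorm q.asIdeal))ˣ,
      u ∈ Subgroup.zpowers (modPCyclotomicCharacterZMod (q.adicCompletion K) (Ideal.absNorm q.asIdeal) t₀))
    (inv : LocalInvariants K p) (hperf : inv.IsPerfect)
    (P : ContPairing (GaloisRep.toLocal q (κ.twistModP ρ hM J)).toTopRep
      (GaloisRep.toLocal q (κ.invTwist.twistModP ρ' hM' J)).toTopRep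
      ((DiscreteGaloisModule.mu K p).toLocal (Sum.inr q)).toTopRep)
    (hP : ∀ x y, P.toLin x y = gorensteinPairing e J x y)
    (S : (GaloisRep.toLocal q (κ.twistModP ρ hM J)).toContRepresentation →ⁱL
      (GaloisRep.toLocal q (κ.twistModP ρ hM J)).toContRepresentation)
    (hS : ∀ x, S x = shiftEnd M J x) :
    ∃ u : ℕ → ZMod p, u 0 ≠ 0 ∧
      ∀ k < J, ∀ (φ : contOneCocycles (GaloisRep.toLocal q (κ.twistModP ρ hM J)).toTopRep)
        (ψ : contOneCocycles (GaloisRep.toLocal q (κ.invTwist.twistModP ρ' hM' J)).toTopRep),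
        oneCocycleClass _ φ ∈ DiscreteGaloisModule.transverseSubgroup
          (GaloisRep.toLocal q (κ.twistModP ρ hM J))
          (CyclotomicField (Ideal.absNorm q.asIdeal) (q.adicCompletion K)) →
        (∀ t ∈ absInertia (q.adicCompletion K), ψ.1 t = 0) →
        inv (Sum.inr q) (P.cupProduct
            ((galoisCohomology.map S 1)^[J - 1 - k] (oneCocycleClass _ φ)) (oneCocycleClass _ ψ)) =
          ∑ j ∈ Finset.range (k + 1), u j * ι (convCoeff e J (k - j) (φ.1 t₀) (ψ.1 Fr)) := by
  classical
  have hJ : 0 < J := by omega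
  obtain ⟨u, hu⟩ := exists_inv_cupProduct_eq_sum_convCoeff ρ ρ' hM hM' κ J q ι hι h1 hunr hunr' hqp hpl hχI
    hFr hsplit hsplit' hm hFrm hFrm' ht₀ hgen inv P hP S hS
  refine ⟨u, fun hu0 => ?_, hu⟩
  -- ### PERFECTNESS (KOLY-MEMO §5.11.B (N3)): if `u_0 = 0`, the transverse class `T^{J−1−s}[φ]`,
  -- `φ(t₀) = T^s δ_0 v₀` (`s = J − p^m`), is non-zero but pairs to zero with every unramified class
  have hI : ∀ t ∈ absInertia (q.adicCompletion K), ∀ x : Fin J → M,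
      GaloisRep.toLocal q (κ.twistModP ρ hM J) t x = x :=
    fun _ ht x => toLocal_twistModP_apply_of_mem_absInertia ρ hM κ J q hunr hqp ht x
  have hs1 : J - p ^ m + 1 ≤ J := by
    have : 1 ≤ p ^ m := Nat.one_le_pow _ _ (Fact.out : p.Prime).pos
    omega
  obtain ⟨φ, hφtr, hφval⟩ := exists_transverse_cocycle_apply_eq ρ hM κ J q hunr hqp hpl hχI hFr hsplit hm hFrm
    hFrm' ht₀ hgen (Pi.single (⟨0, hJ⟩ : Fin J) v₀)
  obtain ⟨φ', hφ'1, hφ'2⟩ := map_iterate_oneCocycleClass _ S (J - 1 - (J - p ^ m)) φ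
  have hSit : ∀ (n : ℕ) (v : Fin J → M), (fun x => S x)^[n] v = (shiftEnd M J ^ n) v := by
    intro n v
    induction n with
    | zero => simp
    | succ n ih => rw [Function.iterate_succ_apply', ih, hS, pow_succ', Module.End.mul_apply]
  have hc₀tr : oneCocycleClass _ φ' ∈ DiscreteGaloisModule.transverseSubgroup
      (GaloisRep.toLocal q (κ.twistModP ρ hM J)) (CyclotomicField (Ideal.absNorm q.asIdeal) (q.adicCompletion K)) := by
    rw [← hφ'2]; exact iterate_map_mem_transverseSubgroup _ _ S _ hφtr
  have hc₀val : φ'.1 t₀ = Pi.single (⟨J - 1, by omega⟩ : Fin J) v₀ := by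
    rw [hφ'1, hSit, hφval, shiftEnd_pow_shiftEnd_pow_apply,
      show J - 1 - (J - p ^ m) + (J - p ^ m) = J - 1 by omega]
    exact shiftEnd_pow_single_zero' (by omega) v₀
  have hc₀ne : oneCocycleClass _ φ' ≠ 0 := by
    intro h0
    obtain ⟨ev, hev⟩ := exists_evalInertia (GaloisRep.toLocal q (κ.twistModP ρ hM J)) hI ht₀
    have h1' : ev (oneCocycleClass _ φ') = Pi.single (⟨J - 1, by omega⟩ : Fin J) v₀ := by rw [hev, hc₀val]
    have h2' : ev (oneCocycleClass _ φ') = 0 := by rw [h0]; exact map_zero ev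
    have hv : v₀ = 0 := by
      have := congrFun (h1'.symm.trans h2') ⟨J - 1, by omega⟩
      rwa [Pi.zero_apply, Pi.single_eq_same] at this
    have h3 : ι (e v₀ w₀) = 0 := by rw [hv, e.map_zero, AddMonoidHom.zero_apply, ι.map_zero]
    exact zero_ne_one (h3.symm.trans h1)
  obtain ⟨ψ, hψ0, hne⟩ := exists_unramified_cupProduct_ne_zero_of_transverse ρ ρ' hM hM' κ J q hp he hnd hsurj
    hunr hunr' hqp hpl hχI inv hperf P hP hc₀tr hc₀ne
  apply hne
  -- the identity at `k = s`: only the `j = 0` term survives, and `u_0 = 0`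
  rw [← hφ'2, hu (J - p ^ m) (by omega) φ ψ hφtr hψ0]
  refine Finset.sum_eq_zero fun j hj => ?_
  rw [Finset.mem_range] at hj
  rcases Nat.eq_zero_or_pos j with hj0 | hj0
  · rw [hj0, hu0, zero_mul]
  · rw [hφval, convCoeff_shiftEnd_pow_left_eq' e (J - p ^ m) (by omega : J - p ^ m - j < J), if_neg (by omega),
      ι.map_zero, mul_zero]


end QTerm

end Summit.BirchSwinnertonDyer.BirchSwinnertonDyer.Rank1Residual.LocalSplitPrime

end
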